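import Summits.QuantumFields.QCD.Theorems.WindowExtinction.Negative.SpectralFlowLocal
import Summits.QuantumFields.QCD.Theorems.ExtinctionBuildsQCD.Negative.InertiaPencil

/-!
# Inertia gluing: eigenvalue-count stability under a sub-gap perturbation, and additivity over blocks

Deterministic linear algebra for the modular cell–wall template (crux idea
`Cruxes/TipPricing/Ideas/modular-cell-wall-template.md`, lead c2; serves stub `stub_fixedCouplingSpread` of line
`hermitian-flow-coarea` r2 for crux `TipPricing`, stmt-QuantumFields-8967, and equally 8964-r3's `stub_indexTemplate`):

* `negRootCount_eq_of_gap` — if a Hermitian `A` has all eigenvalues of modulus `> δ` and the Hermitian `B` differs from it by a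
  form bounded by `δ`, then `B` has the same numbers of negative and of positive eigenvalues as `A` and no zero eigenvalue
  (Weyl counting stability, tree `card_filter_lt_neg_le`, in both signs, plus `n₋ + n₊ + n₀ = dim`);
* `det_ne_zero_of_zeroRootCount_eq_zero` — hence `B` is invertible;
* `le_abs_eigenvalues_of_norm_sq_le`, `negRootCount_eq_of_norm_gap` — the same with the gap given in the block-checkable
  form `g²‖v‖² ≤ ‖A v‖²`;
* `charpoly_blockDiagonal_eq_prod`, `negRootCount_blockDiagonal`, `posRootCount_blockDiagonal` — root counts are additive
  over the blocks of a block-diagonal matrix (equal-size blocks `blockDiagonal M`, `M : o → Matrix n n ℂ`: the cells of the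
  template are translates of one cell);
* `negRootCount_eq_sum_of_blocks` — INERTIA GLUING: gapped Hermitian blocks plus a sub-gap Hermitian perturbation on `n × o`
  have `n₋ = Σ_k n₋(block k)` and are invertible.

Supports stmt-QuantumFields-8967 (helper; closes no item).
-/

namespace Summit.QuantumFields.QCD.Cruxes.TipPricing.ModularTemplate

open Matrix Polynomial
open Summit.QuantumFields.QCD.Theorems.ExtinctionBuildsQCD.Negative
open Summit.QuantumFields.QCD.Theorems.WindowExtinction.Negative
open scoped BigOperators

section Gap

variable {n : Type*} [Fintype n] [DecidableEq n]

/-- **Counting stability under a sub-gap perturbation.**  Let `A`, `B` be Hermitian, `|Re v†(B − A)v| ≤ δ‖v‖²` for all `v`,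
`0 ≤ δ`, and suppose every eigenvalue of `A` has modulus `> δ`.  Then `B` has exactly as many negative (resp. positive)
characteristic roots as `A`, and no zero root.  [folklore] -/
theorem negRootCount_eq_of_gap {A B : Matrix n n ℂ} (hA : A.IsHermitian) (hB : B.IsHermitian) {δ : ℝ} (hδ : 0 ≤ δ)
    (hgap : ∀ i, δ < |hA.eigenvalues i|)
    (hE : ∀ v : n → ℂ, |(star v ⬝ᵥ (B - A) *ᵥ v).re| ≤ δ * ∑ i, ‖v i‖ ^ 2) :
    negRootCount B = negRootCount A ∧ posRootCount B = posRootCount A ∧ zeroRootCount B = 0 := by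
  -- Weyl counting in both signs
  have h1 := card_filter_lt_neg_le hA hB (σ := 1) (δ := δ) (Or.inl rfl) hE
  have h2 := card_filter_lt_neg_le hA hB (σ := -1) (δ := δ) (Or.inr rfl) hE
  -- rewrite the four filters
  have e1 : (Finset.univ.filter fun i => (1 : ℝ) * hA.eigenvalues i < -δ) =
      Finset.univ.filter fun i => hA.eigenvalues i < 0 := by
    refine Finset.filter_congr fun i _ => ?_
    rw [one_mul]
    constructor
    · intro h; linarith
    · intro h
      have := hgap i
      rw [abs_of_neg h] at this
      linarith
  have e2 : (Finset.univ.filter fun i => (1 : ℝ) * hB.eigenvalues i < 0) =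
      Finset.univ.filter fun i => hB.eigenvalues i < 0 :=
    Finset.filter_congr fun i _ => by rw [one_mul]
  have e3 : (Finset.univ.filter fun i => (-1 : ℝ) * hA.eigenvalues i < -δ) =
      Finset.univ.filter fun i => 0 < hA.eigenvalues i := by
    refine Finset.filter_congr fun i _ => ?_
    rw [neg_one_mul, neg_lt_neg_iff]
    constructor
    · intro h; linarith
    · intro h
      have := hgap i
      rwa [abs_of_pos h] at this
  have e4 : (Finset.univ.filter fun i => (-1 : ℝ) * hB.eigenvalues i < 0) =
      Finset.univ.filter fun i => 0 < hB.eigenvalues i :=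
    Finset.filter_congr fun i _ => by rw [neg_one_mul, neg_lt_zero]
  rw [e1, e2] at h1
  rw [e3, e4] at h2
  rw [← negRootCount_eq_card hA, ← negRootCount_eq_card hB] at h1
  rw [← posRootCount_eq_card hA, ← posRootCount_eq_card hB] at h2
  -- `A` has no zero eigenvalue
  have hz : zeroRootCount A = 0 := by
    rw [zeroRootCount_eq_card hA, Finset.card_eq_zero, Finset.filter_eq_empty_iff]
    intro i _ h0
    have := hgap i
    rw [h0, abs_zero] at this
    linarith
  have hsA := negRootCount_add_posRootCount_add_zeroRootCount hA
  have hsB := negRootCount_add_posRootCount_add_zeroRootCount hB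
  omega

/-- A Hermitian matrix without zero characteristic root is invertible. [folklore] -/
theorem det_ne_zero_of_zeroRootCount_eq_zero {B : Matrix n n ℂ} (hB : B.IsHermitian) (h : zeroRootCount B = 0) :
    B.det ≠ 0 := by
  rw [hB.det_eq_prod_eigenvalues]
  refine Finset.prod_ne_zero_iff.2 fun i _ => ?_
  rw [zeroRootCount_eq_card hB, Finset.card_eq_zero, Finset.filter_eq_empty_iff] at h
  have hi : hB.eigenvalues i ≠ 0 := h (Finset.mem_univ i)
  exact fun h0 => hi (RCLike.ofReal_eq_zero.mp h0)

/-- **Inertia is constant under a sub-gap perturbation and the perturbed matrix is invertible** (the form used by the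
cell–wall gluing: `A = ⊕_j K_j` gapped, `B = A + E'` with `‖E'‖ ≤ δ`). [folklore] -/
theorem negRootCount_eq_and_det_ne_zero_of_gap {A B : Matrix n n ℂ} (hA : A.IsHermitian) (hB : B.IsHermitian) {δ : ℝ}
    (hδ : 0 ≤ δ) (hgap : ∀ i, δ < |hA.eigenvalues i|)
    (hE : ∀ v : n → ℂ, |(star v ⬝ᵥ (B - A) *ᵥ v).re| ≤ δ * ∑ i, ‖v i‖ ^ 2) :
    negRootCount B = negRootCount A ∧ B.det ≠ 0 := by
  obtain ⟨h1, -, h3⟩ := negRootCount_eq_of_gap hA hB hδ hgap hE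
  exact ⟨h1, det_ne_zero_of_zeroRootCount_eq_zero hB h3⟩

end Gap

section NormGap

variable {n : Type*} [Fintype n] [DecidableEq n]

/-- A lower bound `g² ‖v‖² ≤ ‖A v‖²` on all vectors bounds every eigenvalue of the Hermitian `A` away from `0` by `g`
(apply it to a normalised eigenvector; `g` may have either sign). [folklore] -/
theorem le_abs_eigenvalues_of_norm_sq_le {A : Matrix n n ℂ} (hA : A.IsHermitian) {g : ℝ}
    (h : ∀ v : n → ℂ, g ^ 2 * ∑ i, ‖v i‖ ^ 2 ≤ ∑ i, ‖(A *ᵥ v) i‖ ^ 2) (i : n) :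
    g ≤ |hA.eigenvalues i| := by
  set v : n → ℂ := ⇑(hA.eigenvectorBasis i) with hv
  have hAv : A *ᵥ v = (hA.eigenvalues i : ℂ) • v := by
    have := hA.mulVec_eigenvectorBasis i
    simpa [hv] using this
  have hnorm : ∑ j, ‖v j‖ ^ 2 = 1 := by
    have h1 : ‖hA.eigenvectorBasis i‖ = 1 := hA.eigenvectorBasis.orthonormal.1 i
    have h2 : ‖hA.eigenvectorBasis i‖ ^ 2 = ∑ j, ‖v j‖ ^ 2 := by
      rw [EuclideanSpace.norm_eq, Real.sq_sqrt (Finset.sum_nonneg fun j _ => by positivity)]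
    rw [← h2, h1, one_pow]
  have key := h v
  rw [hnorm, mul_one, hAv] at key
  have h3 : ∑ j, ‖((hA.eigenvalues i : ℂ) • v) j‖ ^ 2 = hA.eigenvalues i ^ 2 * ∑ j, ‖v j‖ ^ 2 := by
    rw [Finset.mul_sum]
    refine Finset.sum_congr rfl fun j _ => ?_
    rw [Pi.smul_apply, smul_eq_mul, norm_mul, Complex.norm_real, Real.norm_eq_abs, mul_pow, sq_abs]
  rw [h3, hnorm, mul_one] at key
  nlinarith [abs_nonneg (hA.eigenvalues i), sq_abs (hA.eigenvalues i)]

/-- **Counting stability, norm-gap form**: if `‖A v‖² ≥ g²‖v‖²` for all `v` with `δ < g`, and `|Re v†(B − A)v| ≤ δ‖v‖²`,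
then `B` has the inertia of `A` and is invertible. [folklore] -/
theorem negRootCount_eq_of_norm_gap {A B : Matrix n n ℂ} (hA : A.IsHermitian) (hB : B.IsHermitian) {δ g : ℝ}
    (hδ : 0 ≤ δ) (hδg : δ < g) (hgap : ∀ v : n → ℂ, g ^ 2 * ∑ i, ‖v i‖ ^ 2 ≤ ∑ i, ‖(A *ᵥ v) i‖ ^ 2)
    (hE : ∀ v : n → ℂ, |(star v ⬝ᵥ (B - A) *ᵥ v).re| ≤ δ * ∑ i, ‖v i‖ ^ 2) :
    negRootCount B = negRootCount A ∧ posRootCount B = posRootCount A ∧ zeroRootCount B = 0 ∧ B.det ≠ 0 := by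
  have hgap' : ∀ i, δ < |hA.eigenvalues i| := fun i =>
    hδg.trans_le (le_abs_eigenvalues_of_norm_sq_le hA hgap i)
  obtain ⟨h1, h2, h3⟩ := negRootCount_eq_of_gap hA hB hδ hgap' hE
  exact ⟨h1, h2, h3, det_ne_zero_of_zeroRootCount_eq_zero hB h3⟩

end NormGap

section Blocks

variable {n o : Type*} [Fintype n] [DecidableEq n] [Fintype o] [DecidableEq o]

/-- The characteristic polynomial of a block-diagonal matrix is the product of the blocks' (the `charmatrix` of a
block-diagonal matrix is block-diagonal; Mathlib `Matrix.det_blockDiagonal`; cf. tree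
`Literature.NumberTheory.Automorphic.Ash2003.charpoly_blockDiagonal`). [folklore] -/
theorem charpoly_blockDiagonal_eq_prod (M : o → Matrix n n ℂ) :
    (blockDiagonal M).charpoly = ∏ k, (M k).charpoly := by
  have h : (blockDiagonal M).charmatrix = blockDiagonal fun k => (M k).charmatrix := by
    ext ⟨i, k⟩ ⟨j, k'⟩
    simp only [charmatrix_apply, blockDiagonal_apply, diagonal_apply, Prod.mk.injEq]
    by_cases hk : k = k'
    · subst hk
      simp
    · simp [hk]
  rw [Matrix.charpoly, h, det_blockDiagonal]
  rfl

/-- Root counts of a block-diagonal matrix are additive over the blocks (any predicate on roots). [folklore] -/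
theorem countP_roots_charpoly_blockDiagonal (M : o → Matrix n n ℂ) (p : ℂ → Prop) [DecidablePred p] :
    (blockDiagonal M).charpoly.roots.countP p = ∑ k, (M k).charpoly.roots.countP p := by
  rw [charpoly_blockDiagonal_eq_prod, Polynomial.roots_prod _ _ (Finset.prod_ne_zero_iff.2 fun k _ =>
    (Matrix.charpoly_monic (M k)).ne_zero)]
  -- `countP` is additive over a finite sum of multisets
  have : ∀ s : Finset o, ((s.val.bind fun k => (M k).charpoly.roots).countP p) =
      ∑ k ∈ s, (M k).charpoly.roots.countP p := by
    intro s
    induction s using Finset.induction_on with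
    | empty => simp
    | insert a s ha ih =>
      rw [Finset.insert_val_of_notMem ha, Multiset.cons_bind, Multiset.countP_add, ih, Finset.sum_insert ha]
  exact this Finset.univ

/-- Negative root counts add over blocks. [folklore] -/
theorem negRootCount_blockDiagonal (M : o → Matrix n n ℂ) :
    negRootCount (blockDiagonal M) = ∑ k, negRootCount (M k) :=
  countP_roots_charpoly_blockDiagonal M _

/-- Positive root counts add over blocks. [folklore] -/
theorem posRootCount_blockDiagonal (M : o → Matrix n n ℂ) :
    posRootCount (blockDiagonal M) = ∑ k, posRootCount (M k) :=
  countP_roots_charpoly_blockDiagonal M _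

omit [DecidableEq n] in
/-- The action of a block-diagonal matrix on a vector, block by block. [folklore] -/
theorem blockDiagonal_mulVec_apply (M : o → Matrix n n ℂ) (v : n × o → ℂ) (i : n) (k : o) :
    (blockDiagonal M *ᵥ v) (i, k) = (M k *ᵥ fun j => v (j, k)) i := by
  simp only [mulVec, dotProduct, Fintype.sum_prod_type, blockDiagonal_apply']
  rw [Finset.sum_comm]
  simp

omit [DecidableEq n] in
/-- A uniform norm gap of the blocks is a norm gap of the block-diagonal matrix. [folklore] -/
theorem norm_sq_mulVec_blockDiagonal_ge (M : o → Matrix n n ℂ) {g : ℝ}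
    (h : ∀ (k : o) (w : n → ℂ), g ^ 2 * ∑ i, ‖w i‖ ^ 2 ≤ ∑ i, ‖(M k *ᵥ w) i‖ ^ 2) (v : n × o → ℂ) :
    g ^ 2 * ∑ x, ‖v x‖ ^ 2 ≤ ∑ x, ‖(blockDiagonal M *ᵥ v) x‖ ^ 2 := by
  rw [Fintype.sum_prod_type_right, Fintype.sum_prod_type_right, Finset.mul_sum]
  refine Finset.sum_le_sum fun k _ => ?_
  have := h k fun j => v (j, k)
  refine this.trans (le_of_eq (Finset.sum_congr rfl fun i _ => ?_))
  rw [blockDiagonal_mulVec_apply]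

/-- **Inertia gluing.**  Blocks `M k` (Hermitian, each with norm gap `g`) and a Hermitian `B` on `n × o` differing from
`blockDiagonal M` by a form bounded by `δ < g`: then `n₋(B) = Σ_k n₋(M k)` and `B` is invertible.  This is the deterministic
core of the cell–wall template: `M k` = the dressed cell operators, `B` = the Schur complement of the box block of
`Γ₅(D_W − δ)` with respect to the coercive wall block, `δ` = the exponentially small inter-cell coupling. [folklore] -/
theorem negRootCount_eq_sum_of_blocks {M : o → Matrix n n ℂ} (hM : ∀ k, (M k).IsHermitian) {B : Matrix (n × o) (n × o) ℂ}
    (hB : B.IsHermitian) {δ g : ℝ} (hδ : 0 ≤ δ) (hδg : δ < g)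
    (hgap : ∀ (k : o) (w : n → ℂ), g ^ 2 * ∑ i, ‖w i‖ ^ 2 ≤ ∑ i, ‖(M k *ᵥ w) i‖ ^ 2)
    (hE : ∀ v : n × o → ℂ, |(star v ⬝ᵥ (B - blockDiagonal M) *ᵥ v).re| ≤ δ * ∑ x, ‖v x‖ ^ 2) :
    negRootCount B = ∑ k, negRootCount (M k) ∧ B.det ≠ 0 := by
  have hA : (blockDiagonal M).IsHermitian := by
    rw [Matrix.IsHermitian, blockDiagonal_conjTranspose]
    congr 1
    funext k
    exact hM k
  obtain ⟨h1, -, -, h4⟩ := negRootCount_eq_of_norm_gap hA hB hδ hδg (norm_sq_mulVec_blockDiagonal_ge M hgap) hE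
  exact ⟨h1.trans (negRootCount_blockDiagonal M), h4⟩

end Blocks

end Summit.QuantumFields.QCD.Cruxes.TipPricing.ModularTemplate
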